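import Literature.NumberTheory.Automorphic.PairLFunctionMeromorphicContinuation
import Literature.NumberTheory.Automorphic.PairLFunctionBoundaryProofs
import HarnessLib

/-!
# Arthur–Clozel (2.2) off `s = 1`: the Jacquet–Shalika half (continuous extension to the line)
# and the Shahidi half (non-vanishing of the boundary values) as named facts, and the assembly

Topic `NumberTheory/Automorphic`; namespace `Literature.NumberTheory.Automorphic`.
Fact-decomposition record (librarian, `fact-decompose`, 2026-08-16) for the named fact
`JacquetShalika1981_partialPairL_boundary_of_ne_one` (`PairLFunctionPoles.lean`; Arthur–Clozel,
Ann. of Math. Stud. 120, Ch. 3 §2, (2.2), p. 171, at the points `s₀ ≠ 1` of `Re s = 1`: for unitary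
cuspidal `π` on `GL_n(𝔸_K)`, `σ` on `GL_m(𝔸_K)` and Satake families `α`, `β` off a finite `S`,
`L^S(s, π ⊗ σ) = partialPairL S α β s` has a finite NON-ZERO limit as `s → s₀`, `Re s > 1`).

The printed sentence has two halves with two printed attributions — "(cf. [27(b), Prop. 3.6]. The
non-vanishing part of these results is due to Shahidi [36(a)])" [cite: ArthurClozelAMS120, Ch. 3 §2 (2.2), p. 171]:
* (JS) "the function `L^S` extends continuously to the line `Re s = 1` with `X` removed" —
  Jacquet–Shalika II, Prop. 3.6 (global Rankin–Selberg integrals), here `X ⊆ {1}` in the tree's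
  `A_G`-trivial `L²` model (`PairLFunctionPoles`, module docstring item 2);
* (Sh) "Moreover, it does not vanish there" — Shahidi 1980/1981 (`L_S(1 + it, π × π') ≠ 0`,
  Eisenstein series on `GL_{n+m}` and the Casselman–Shalika formula).
`PairLFunctionBoundaryProofs` records exactly this architecture for the fact, with both halves as
inline hypotheses `hJS`, `hSh` and the bookkeeping PROVED
(`JacquetShalika1981_partialPairL_boundary_of_ne_one_of_halves`, `…_iff_parts`: the fact is
equivalent to the conjunction of its halves at the points `s₀ ≠ 1`), "Under the fact-decomposition
discipline (D-0026) the halves are not vendored as further named facts" — which is what the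
librarian's `fact-decompose` pass (human 2026-08-16) now does.

This file NAMES the two halves as the facts
`JacquetShalika1981_partialPairL_continuousOn_line_of_ne_one` (JS: a continuous extension of `L^S`
to `{1 ≤ re s} ∖ {1}` — the hypothesis `hJS` of `…_of_halves` verbatim) and
`Shahidi1980_partialPairL_boundaryValue_ne_zero` (Sh: every boundary value of `L^S` at `1 + it`,
`t` real, taken from `Re s > 1`, is non-zero — the junk-robust rendering of "does not vanish", the
hypothesis `hSh` of `…_of_halves` verbatim), quantified exactly like the parent (section variables
`n m K μ μ'`), and records the assembly `JacquetShalika1981_partialPairL_boundary_of_ne_one_holds_of`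
(one line). It also records how much of (JS) the
tree's continuation facts already give: for `n ≠ m` it follows from
`MoeglinWaldspurger1989_partialPairL_entire_of_rank_ne` (entire continuation), and for `m = n` with
both representations in the SAME `L²_cusp` (one measure `μ`) from
`MoeglinWaldspurger1989_partialPairL_entire_of_ne_conj` / `…_of_eq_conj` and `multiplicity_one_gl`
(`continuousOn_line_of_moeglinWaldspurger_rank_ne`, `…_same_rank`); what those do not cover is only
the bookkeeping case `m = n` with two different automorphic measures `μ ≠ μ'` (unique up to a positive
scalar, `isAutomorphicMeasure_unique_smul`; no transport of `CuspidalAutomorphicRepGL` between them in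
the tree yet).

## References

* [ArthurClozelAMS120] J. Arthur, L. Clozel, Simple algebras, base change, and the advanced theory
  of the trace formula, Ann. of Math. Stud. 120 (1989), Ch. 3 §2, (2.1)–(2.3), p. 171.
* [JacquetShalikaAJM1981II] H. Jacquet, J. A. Shalika, On Euler products and the classification of
  automorphic forms II, Amer. J. Math. 103 (1981), 777–815, Prop. 3.6.
* [ShahidiBAMS1980] F. Shahidi, On nonvanishing of `L`-functions, Bull. Amer. Math. Soc. (N.S.) 2
  (1980), 462–464, Theorem (p. 462). [ShahidiAJM1981] F. Shahidi, On certain `L`-functions, Amer.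
  J. Math. 103 (1981), 297–355, §5.
* [MoeglinWaldspurger1989] C. Mœglin, J.-L. Waldspurger, Le spectre résiduel de `GL(n)`, Ann. Sci.
  ÉNS 22 (1989), Appendice, p. 667.
-/

noncomputable section

open scoped MatrixGroups Topology
open NumberField IsDedekindDomain MeasureTheory Filter Complex

namespace Literature.NumberTheory.Automorphic

open AdelicGroupData

/-! ### The two halves of (2.2) off `s = 1` (named facts) -/

section Facts

variable {n m : ℕ} {K : Type} [Field K] [NumberField K]
  {μ : Measure (gl n K).automorphicQuotient} [(gl n K).IsAutomorphicMeasure μ]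
  {μ' : Measure (gl m K).automorphicQuotient} [(gl m K).IsAutomorphicMeasure μ']

/-- NAMED FACT — **Jacquet–Shalika: `L^S(s, π ⊗ σ)` extends continuously to the line `Re s = 1`
with `s = 1` removed** (Arthur–Clozel, Ch. 3, (2.2), first sentence: "the function `L^S` extends
continuously to the line `Re s = 1` with `X` removed"; Jacquet–Shalika II, Prop. 3.6). For unitary
cuspidal `π` on `GL_n(𝔸_K)` and `σ` on `GL_m(𝔸_K)` (`n, m ≥ 1`) with Satake families `α`, `β` off a
finite set `S` of finite places, there is `g : ℂ → ℂ` continuous on `{s | 1 ≤ re s} ∖ {1}` and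
equal to `partialPairL S α β` on `{s | 1 < re s}`. In the tree's `A_G`-trivial `L²` model
`X ⊆ {1}` (`PairLFunctionPoles`, module docstring item 2), so removing `1` loses nothing of the
printed statement off `X`; the point `s = 1` is the business of
`JacquetShalika1981_partialPairL_at_one_of_rank_ne`, `…_at_one_of_ne_conj` and (2.3). For `n ≠ m`,
and for `m = n` in a common `L²_cusp`, this follows from the Mœglin–Waldspurger continuation facts
(`continuousOn_line_of_moeglinWaldspurger_rank_ne`, `…_same_rank` below). Users take
`(h : JacquetShalika1981_partialPairL_continuousOn_line_of_ne_one)`.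
[cite: ArthurClozelAMS120, Ch. 3 §2 (2.2), p. 171] [cite: JacquetShalikaAJM1981II, Prop. 3.6] -/
def JacquetShalika1981_partialPairL_continuousOn_line_of_ne_one : Prop :=
  ∀ (_hn : 0 < n) (_hm : 0 < m) (P : CuspidalAutomorphicRepGL n K μ)
    (P' : CuspidalAutomorphicRepGL m K μ') {S : Set (HeightOneSpectrum (𝓞 K))} (_hS : S.Finite)
    {α β : SatakeFamily K} (_hα : IsSatakeFamilyOf P S α) (_hβ : IsSatakeFamilyOf P' S β),
    ∃ g : ℂ → ℂ, ContinuousOn g ({s : ℂ | 1 ≤ s.re} \ {1}) ∧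
      Set.EqOn g (partialPairL S α β) {s : ℂ | 1 < s.re}

/-- NAMED FACT — **Shahidi: the boundary values of `L^S(s, π ⊗ σ)` on `Re s = 1` do not vanish**
(Arthur–Clozel, Ch. 3, (2.2), second sentence: "Moreover, it does not vanish there", "The
non-vanishing part of these results is due to Shahidi"; Shahidi 1980, Theorem p. 462:
"`L_S(1 + it, π × π') ≠ 0` for all `t ∈ ℝ`", cuspidal `π` on `GL_n`, `π'` on `GL_m`; Shahidi 1981,
§5). Rendered junk-robustly on the tree's `partialPairL` (a genuine value only where the Euler
product converges), verbatim the hypothesis `hSh` of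
`JacquetShalika1981_partialPairL_boundary_of_ne_one_of_halves`: for unitary cuspidal `π` on
`GL_n(𝔸_K)`, `σ` on `GL_m(𝔸_K)` (`n, m ≥ 1`), Satake families `α`, `β` off a finite `S`, every real
`t` and every `c`: if `partialPairL S α β s → c` as `s → 1 + it`, `Re s > 1`, then `c ≠ 0` (at a
point of `X ⊆ {1}` no finite limit exists, by (2.3), so nothing is asserted there). Users take
`(h : Shahidi1980_partialPairL_boundaryValue_ne_zero)`.
[cite: ArthurClozelAMS120, Ch. 3 §2 (2.2), p. 171] [cite: ShahidiBAMS1980, Theorem (p. 462)] -/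
def Shahidi1980_partialPairL_boundaryValue_ne_zero : Prop :=
  ∀ (_hn : 0 < n) (_hm : 0 < m) (P : CuspidalAutomorphicRepGL n K μ)
    (P' : CuspidalAutomorphicRepGL m K μ') {S : Set (HeightOneSpectrum (𝓞 K))} (_hS : S.Finite)
    {α β : SatakeFamily K} (_hα : IsSatakeFamilyOf P S α) (_hβ : IsSatakeFamilyOf P' S β)
    (t : ℝ) {c : ℂ}
    (_hc : Tendsto (partialPairL S α β) (𝓝[{s : ℂ | 1 < s.re}] (1 + t * Complex.I)) (𝓝 c)),
    c ≠ 0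

/-! ### Assembly -/

/-- **Assembly (fact-decompose): Arthur–Clozel (2.2) off `s = 1` from its two halves.**
`JacquetShalika1981_partialPairL_boundary_of_ne_one` follows from the Jacquet–Shalika half
(`JacquetShalika1981_partialPairL_continuousOn_line_of_ne_one`) and the Shahidi half
(`Shahidi1980_partialPairL_boundaryValue_ne_zero`): the continuous extension `g` computes the
boundary limit `g s₀`, which is then non-zero (`JacquetShalika1981_partialPairL_boundary_of_ne_one_of_halves`,
proved in `PairLFunctionBoundaryProofs`). [cite: ArthurClozelAMS120, Ch. 3 §2 (2.2), p. 171] -/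
theorem JacquetShalika1981_partialPairL_boundary_of_ne_one_holds_of
    (hJS : JacquetShalika1981_partialPairL_continuousOn_line_of_ne_one (n := n) (m := m) (K := K)
      (μ := μ) (μ' := μ'))
    (hSh : Shahidi1980_partialPairL_boundaryValue_ne_zero (n := n) (m := m) (K := K) (μ := μ)
      (μ' := μ')) :
    JacquetShalika1981_partialPairL_boundary_of_ne_one (n := n) (m := m) (K := K) (μ := μ)
      (μ' := μ') :=
  JacquetShalika1981_partialPairL_boundary_of_ne_one_of_halves hJS hSh

/-! ### How much of the Jacquet–Shalika half the continuation facts already give -/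

/-- (JS) for **different ranks** from `MoeglinWaldspurger1989_partialPairL_entire_of_rank_ne`: an
entire continuation is in particular continuous on `{1 ≤ re s} ∖ {1}`.
[cite: MoeglinWaldspurger1989, Appendice, Corollaire (i)(a), p. 667] -/
theorem continuousOn_line_of_moeglinWaldspurger_rank_ne
    (h : MoeglinWaldspurger1989_partialPairL_entire_of_rank_ne (n := n) (m := m) (K := K) (μ := μ)
      (μ' := μ'))
    (hnm : n ≠ m) (hn : 0 < n) (hm : 0 < m) (P : CuspidalAutomorphicRepGL n K μ)
    (P' : CuspidalAutomorphicRepGL m K μ') {S : Set (HeightOneSpectrum (𝓞 K))} (hS : S.Finite)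
    {α β : SatakeFamily K} (hα : IsSatakeFamilyOf P S α) (hβ : IsSatakeFamilyOf P' S β) :
    ∃ g : ℂ → ℂ, ContinuousOn g ({s : ℂ | 1 ≤ s.re} \ {1}) ∧
      Set.EqOn g (partialPairL S α β) {s : ℂ | 1 < s.re} := by
  obtain ⟨g, hg, hgL⟩ := h hnm hn hm P P' hS hα hβ
  exact ⟨g, hg.continuous.continuousOn, fun s hs => hgL s hs⟩

omit [(gl m K).IsAutomorphicMeasure μ'] in
/-- (JS) for **equal ranks, both representations in the same `L²_cusp`** (one automorphic measure
`μ`), from `MoeglinWaldspurger1989_partialPairL_entire_of_ne_conj` (needs `multiplicity_one_gl`) and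
`MoeglinWaldspurger1989_partialPairL_of_eq_conj`: if `π ≅ σ̃` (`P = P'.conj`) then
`L^S = G / (s (s - 1))` with `G` entire is continuous off `{0, 1} ⊇ ({1 ≤ re s} ∖ {1})ᶜ`-wise,
otherwise `L^S` has an entire continuation.
[cite: MoeglinWaldspurger1989, Appendice, Corollaire (i)(b) and (ii), p. 667] -/
theorem continuousOn_line_of_moeglinWaldspurger_same_rank
    (hb : MoeglinWaldspurger1989_partialPairL_entire_of_ne_conj (n := n) (K := K) (μ := μ))
    (hc : MoeglinWaldspurger1989_partialPairL_of_eq_conj (n := n) (K := K) (μ := μ))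
    (h₁ : multiplicity_one_gl n K μ)
    (hn : 0 < n) (P P' : CuspidalAutomorphicRepGL n K μ)
    {S : Set (HeightOneSpectrum (𝓞 K))} (hS : S.Finite)
    {α β : SatakeFamily K} (hα : IsSatakeFamilyOf P S α) (hβ : IsSatakeFamilyOf P' S β) :
    ∃ g : ℂ → ℂ, ContinuousOn g ({s : ℂ | 1 ≤ s.re} \ {1}) ∧
      Set.EqOn g (partialPairL S α β) {s : ℂ | 1 < s.re} := by
  by_cases he : P = P'.conj
  · obtain ⟨G, hG, hGL⟩ := hc hn P P' he hS hα hβ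
    refine ⟨fun s => G s / (s * (s - 1)), ?_, ?_⟩
    · intro s hs
      have hs1 : s ≠ 1 := hs.2
      have hs0 : s ≠ 0 := by
        rintro rfl
        have : (1 : ℝ) ≤ (0 : ℂ).re := hs.1
        simp at this
        linarith
      have hden : s * (s - 1) ≠ 0 := mul_ne_zero hs0 (sub_ne_zero.mpr hs1)
      exact ((hG.continuous.continuousAt).div
        ((continuous_id.mul (continuous_id.sub continuous_const)).continuousAt) hden).continuousWithinAt
    · intro s hs
      have hs' : 1 < s.re := hs
      have hs1 : s ≠ 1 := by rintro rfl; simp at hs'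
      have hs0 : s ≠ 0 := by rintro rfl; simp at hs'; linarith
      have hden : s * (s - 1) ≠ 0 := mul_ne_zero hs0 (sub_ne_zero.mpr hs1)
      simp only
      rw [hGL s hs', mul_div_assoc]
      field_simp
  · obtain ⟨g, hg, hgL⟩ := hb hn h₁ P P' he hS hα hβ
    exact ⟨g, hg.continuous.continuousOn, fun s hs => hgL s hs⟩

end Facts

end Literature.NumberTheory.Automorphic

end
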